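import Summits.KontsevichZagierPeriods.Zeta5Search.LaiSweepShard

/-!
# `κ₃` sweep certificate — shard file 039 of 127 (shards 273–279 of 889)

HONEST FRAMING. Systematic search; no irrationality claim unless certified. This file only checks,
by `decide +kernel`, shards 273–279 of the order-cell sweep of the `κ₃` point `(74, 2180, 444; δ74)`
(engine `LaiSweepEngine`, soundness `LaiSweepJump/Free/Eval/Shard/Kappa3`; a shard is `⟨regime, n,
p, q, p', q', Lo, Up⟩`: `n` cells from `p/q` to `p'/q'` with integer rate sums in `[Lo, Up]`, `K =
128`, `D = 2^40`). It draws NO conclusion: only the capstone `LaiKappa3SweepCert`, which needs all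
127 shard files, does. Kernel cost of this file ≈ 560 cells × 0.3 s.
-/

namespace Summit.KontsevichZagierPeriods.Zeta5Search.Sweep

set_option maxHeartbeats 100000000 in
/-- Shard 273: 80 cells of regime B from `73/324` to `46/203`.
[cite: Lai2024BallRivoal, §4 Lemma 4.3] -/
theorem shard273 :
    Shard.check 128 (2^40)
      ⟨true, 80, 73, 324, 46, 203, 30017339100631, 31142387303267⟩ = true := by
  decide +kernel

set_option maxHeartbeats 100000000 in
/-- Shard 274: 80 cells of regime B from `46/203` to `18/79`.
[cite: Lai2024BallRivoal, §4 Lemma 4.3] -/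
theorem shard274 :
    Shard.check 128 (2^40)
      ⟨true, 80, 46, 203, 18, 79, 28766446534679, 29858872966300⟩ = true := by
  decide +kernel

set_option maxHeartbeats 100000000 in
/-- Shard 275: 80 cells of regime B from `18/79` to `74/323`.
[cite: Lai2024BallRivoal, §4 Lemma 4.3] -/
theorem shard275 :
    Shard.check 128 (2^40)
      ⟨true, 80, 18, 79, 74, 323, 28834885047773, 29943234579483⟩ = true := by
  decide +kernel

set_option maxHeartbeats 100000000 in
/-- Shard 276: 80 cells of regime B from `74/323` to `44/191`.
[cite: Lai2024BallRivoal, §4 Lemma 4.3] -/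
theorem shard276 :
    Shard.check 128 (2^40)
      ⟨true, 80, 74, 323, 44, 191, 28876451852678, 30000241933624⟩ = true := by
  decide +kernel

set_option maxHeartbeats 100000000 in
/-- Shard 277: 80 cells of regime B from `44/191` to `60/259`.
[cite: Lai2024BallRivoal, §4 Lemma 4.3] -/
theorem shard277 :
    Shard.check 128 (2^40)
      ⟨true, 80, 44, 191, 60, 259, 29477860585651, 30641749710204⟩ = true := by
  decide +kernel

set_option maxHeartbeats 100000000 in
/-- Shard 278: 80 cells of regime B from `60/259` to `92/395`.
[cite: Lai2024BallRivoal, §4 Lemma 4.3] -/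
theorem shard278 :
    Shard.check 128 (2^40)
      ⟨true, 80, 60, 259, 92, 395, 28322115338327, 29452749141337⟩ = true := by
  decide +kernel

set_option maxHeartbeats 100000000 in
/-- Shard 279: 80 cells of regime B from `92/395` to `37/158`.
[cite: Lai2024BallRivoal, §4 Lemma 4.3] -/
theorem shard279 :
    Shard.check 128 (2^40)
      ⟨true, 80, 92, 395, 37, 158, 28552265460601, 29706686142921⟩ = true := by
  decide +kernel

/-- The checked shards of this file, in order. [folklore] -/
def shards039 : List (CheckedShard 128 (2^40)) :=
  [⟨_, shard273⟩, ⟨_, shard274⟩, ⟨_, shard275⟩, ⟨_, shard276⟩, ⟨_, shard277⟩,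
    ⟨_, shard278⟩, ⟨_, shard279⟩]

end Summit.KontsevichZagierPeriods.Zeta5Search.Sweep
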